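/-
Copyright (c) 2026. All rights reserved.
Released under Apache 2.0 license as described in the file LICENSE.
Authors: abc-iut cell, prover seat abc-iut-w5-d144 (gen 6; row «COR510iv-SB′», abc-iut-L4-lead m127), over the
statements of abc-iut-L4-t3 (`LogFrobeniusMonoTelecorePinned`, `LogFrobeniusObservables`, `LogFrobeniusObservablesTelecore`,
`LogFrobeniusIncompatibility`) — statements only; nothing of those files is re-meant.
-/
import Literature.AnabelianGeometry.AbsoluteAnabelian.LogFrobeniusMonoTelecorePinned
import Literature.AnabelianGeometry.AbsoluteAnabelian.LogFrobeniusObservablesTelecore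
import Literature.AnabelianGeometry.AbsoluteAnabelian.LogFrobeniusMonoBaseFacts
import Literature.AnabelianGeometry.AbsoluteAnabelian.LogFrobeniusIotaAnMono
import HarnessLib

/-!
# [AbsTopIII] Corollary 5.10 (iv)(b), last sentence, and the observable clause of (iv)(c): the mono-analytic telecore
# `𝔗_{An⊢}` (resp. its contact structure `ℋ_{An⊢}`) is COMPATIBLE with the observables `S_log`, `S_log⊞` of Cor 5.5 (iii)

S. Mochizuki, *Topics in absolute anabelian geometry III: global reconstruction algorithms*,
J. Math. Sci. Univ. Tokyo 22 (2015) 939–1156 [MochizukiAbsTopIII2015]; locators `p.N` = pages of the author's manuscript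
(`paper:url-5493eb38cbb7`), read on the page (cell render p0147 l.54–65, p0148 l.1–8, l.39–51): Cor 5.10 (iv)(b)
pp. 147–148: "… give rise to a telecore structure `𝔗_{An⊢}` on `D•⊢_{≤5} ∪ D•_{≤6}`, whose underlying diagram of categories we
denote by `D_{An⊢}`, by appending to `D•⊢_{≤6}` telecore edges … from the core `An⊢[𝒩⊢⊞]` to the vertices of the row of
`D⊢` indexed by the integer 3. **Moreover, the respective family of homotopies of `𝔗_{An⊢}` and the observables `S_log`,
`S_log⊞` of Corollary 5.5, (iii), are compatible.**"; (iv)(c) p. 148 l.39–51: "… generate a contact structure `ℋ_{An⊢}` on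
`𝔗_{An⊢}` that is compatible with the telecore and contact structures `𝔗_{An•}`, `ℋ_{An•}` of Corollary 5.5, (ii), as well as
**with the homotopies of the observables `S_log`, `S_log⊞` of Corollary 5.5, (iii), that arise from the "`ι⊞_{v,ε}`",
"`ι_{v,ε}`" indexed by `ε ∈ Γ⃗×_v` [not `Γ⃗^log_v`!]**"; Def 3.5 (ii) p. 75 ("compatible" = contained in one family of
homotopies, with the same homotopies).

WHY THIS FILE.  abc-iut-L4-t3's print-faithful row `LogFrobeniusSetting.Cor510MonoTelecorePinned` types (iv)(b)(c) WITHOUT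
the two compatibility sentences quoted in bold (its docstring: "TODO(general form)"); abc-iut-f-101 closed that row at the
GENUINE nonarchimedean open-augmentation carrier (`cor510MonoTelecorePinned_genuineOpen`, p481393) and the L4-lead ruled
(m127) that the node stays PARTIAL until the (b)-sentence `s_b′` is TYPED and closed.  Here `s_b′` is typed VERBATIM in the
shape abc-iut-L4-t3 used for its holomorphic twin (Cor 5.5 (iii), last sentence, inside the telecore diagram `D_{An•}`:
`Cor55ObservablesTelecoreCompatible`), transposed to the mono-analytic telecore diagram `D_{An⊢}`:

* `monoTelecoreShape J` / `L.monoTelecoreDiagram J tel` — `D_{An⊢}`: `D•⊢_{≤5} ∪ D•_{≤6}` (`monoBase 6`) extended by the core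
  vertex `An⊢[𝒩⊢⊞]` with the arrows of `D•⊢` into it as observation edges and telecore edges `J` (the diagram on which
  `Cor510MonoTelecorePinned` places the contact structure, by `rfl`);
* `embMonoPlus J v`, `embMonoTS J v` — the inclusions of oriented graphs of the observables' diagrams
  `D•_{≤2} ∪ {𝒩⊞_v}` (`S_log⊞_v`) and `(D•_{≤3})_v ∪ {𝒩_v}` (`S_log_v`) into `Γ⃗_{D_{An⊢}}` (both are holomorphic sub-diagrams of
  `D•_{≤6} ⊆ D•⊢_{≤5} ∪ D•_{≤6}`; `monoBase_six_of_inTwo`, `monoBase_six_of_inPortionThree`);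
* `CompatibleInMonoTelecorePlus/TS` — a family on the observable's diagram EMBEDS into a family `K` on `D_{An⊢}` (same
  boundary pairs after embedding, same homotopies; abc-iut-L4-t3's `CompatibleInTelecorePlus/TS` verbatim);
* ★ `Cor510MonoTelecoreObservablesCompatible L TS` — **Cor 5.10 (iv)(b), last sentence (`s_b′`)**: the data of the pinned
  telecore `𝔗_{An⊢}` (core family, telecore with `hJ : T.J = MonoTelecoreIdx` and the telecore functors `φ^{An⊢⊞}_{v,ν}`),
  observable structures `S_log⊞_v` (`IsLogObservablePlus`) and `S_log_v` (`IsLogObservableTS TS`) at every `v ∈ V(F_mod)`, and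
  ONE family of homotopies `K` on `D_{An⊢}` containing the telecore family `𝒥` (`SubFamily T.Jfam K`) and the embedded families
  of ALL the `S_log⊞_v`, `S_log_v` (log-edge pairs INCLUDED);
* ★ `Cor510MonoContactObservablesCompatible L TS` — **the observable clause of Cor 5.10 (iv)(c)**: the pinned row's telecore
  AND contact structure `ℋ_{An⊢}` (with the pinned pairs `(γ¹_{v,ν}, γ⁰_{v,ν})` in both orders, verbatim), observable structures
  at every `v`, and ONE family `K′` on `D_{An⊢}` containing `𝒥`, `ℋ_{An⊢}` and the embedded observable homotopies indexed by the
  edges of `Γ⃗×_v` ONLY (`LogEdgeTS.InCore`: the generator pairs `([λ_{v,ν₁}], [λ_{v,ν₂}])` of `IsLogObservablePlus/TS`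
  clause (2) for `ε ∈ Γ⃗×_v`; the log-edge pairs of clause (3) and the space-link edge are EXCLUDED, as print insists);
* bookkeeping: `isCoreOn_anMono_of_observablesCompatible`, `cor55Observables_of_observablesCompatible` /
  `…_of_contactObservablesCompatible` (the statements refine Cor 5.10 (iv)(a) `n = 6` and the existence clauses of Cor 5.5
  (iii)); `cor510MonoTelecorePinned_of_contactObservablesCompatible` (the (c)-clause statement refines the pinned row);
  `not_…_of_isEmpty` (degenerate boundary `V(F_mod) = ∅`: FALSE as typed, exactly as the pinned row — `□` does not reach
  `An⊢[𝒩⊢⊞]`; an assumption on the genuine theaters, `V(F_mod) ≠ ∅`).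

NOT typed here (honest scope, successor rows): the compatibility of `ℋ_{An⊢}` with `𝔗_{An•}`, `ℋ_{An•}` (Cor 5.5 (ii)) — the
two telecore diagrams `D_{An•}`, `D_{An⊢}` are different extensions of `D•_{≤5}`, a common super-diagram is needed
(abc-iut-L4-lead m127: model-level label); the `ι^{An⊢⊞}`-generation clause (abc-iut-L4-t3's `IotaAnMono` / `EtaNatural` lane).
Every `Prop` is an ASSUMPTION on `(L, TS)` asserted by the text for the genuine theaters (typed ≠ proved; closers at genuine
carriers are separate files).  Refereed pre-IUT material; nothing here bears on [IUTchIII] Cor. 3.12; no side taken.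
-/

universe u

open CategoryTheory Quiver

namespace Literature.AnabelianGeometry.AbsoluteAnabelian

namespace LogFrobeniusSetting

variable {Vmod : Type u} {isArc : Vmod → Bool} (L : LogFrobeniusSetting Vmod isArc)

/-! ## The mono-analytic telecore diagram `D_{An⊢}` and the embeddings of the observables' diagrams -/

/-- `D•_{≤2} ⊆ D•⊢_{≤5} ∪ D•_{≤6}`. [cite: MochizukiAbsTopIII2015, Cor 5.10 (iv)(b) p. 147] -/
theorem monoBase_six_of_inTwo {x : DVertex Vmod isArc} (h : x.InFirstRows 2) : monoBase (isArc := isArc) 6 x :=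
  monoBase_of_inFirstRows ⟨h.1, h.2.trans (by decide)⟩

/-- the portion of `D•_{≤3}` indexed by `v` lies in `D•⊢_{≤5} ∪ D•_{≤6}`. [cite: MochizukiAbsTopIII2015, Cor 5.10 (iv)(b) p. 147] -/
theorem monoBase_six_of_inPortionThree {v : Vmod} {x : DVertex Vmod isArc} (h : InPortionThree v x) :
    monoBase (isArc := isArc) 6 x := by
  rcases h with h | rfl
  · exact monoBase_six_of_inTwo h
  · exact monoBase_six_nplus v

/-- the shape of the telecore `𝔗_{An⊢}`: `D•⊢_{≤5} ∪ D•_{≤6}` extended by the core vertex `An⊢[𝒩⊢⊞]` with the arrows of `D•⊢` into it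
as observation edges and telecore edges `J`. [cite: MochizukiAbsTopIII2015, Cor 5.10 (iv)(b) pp. 147–148] -/
abbrev monoTelecoreShape (J : DSub (monoBase (Vmod := Vmod) (isArc := isArc) 6) → Type u) :
    ExtShape.{u} (DSub (monoBase (Vmod := Vmod) (isArc := isArc) 6)) :=
  ⟨(obsShape (monoBase (isArc := isArc) 6) DVertex.anMono).I, J⟩

/-- the underlying diagram of categories `D_{An⊢}` of the telecore, for telecore edges `J` realised by functors `tel` — the
diagram on which `Cor510MonoTelecorePinned` places the contact structure `ℋ_{An⊢}` (same term).
[cite: MochizukiAbsTopIII2015, Cor 5.10 (iv)(b) p. 148] -/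
abbrev monoTelecoreDiagram (J : DSub (monoBase (Vmod := Vmod) (isArc := isArc) 6) → Type u)
    (tel : ∀ {a : DSub (monoBase (Vmod := Vmod) (isArc := isArc) 6)}, J a → (L.AnMono ⥤ a.1.category L)) :=
  (L.subdiagram (monoBase 6)).extend (X := monoTelecoreShape J) ⟨L.AnMono, fun e => DEdge.functor L e, tel⟩

section Embeddings

variable (J : DSub (monoBase (Vmod := Vmod) (isArc := isArc) 6) → Type u)

/-- the inclusion of oriented graphs `Γ⃗_{D•_{≤2} ∪ {𝒩⊞_v}} ↪ Γ⃗_{D_{An⊢}}` (the observation vertex `𝒩⊞_v` of `S_log⊞` is a vertex of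
`D•_{≤6} ⊆ D•⊢_{≤5} ∪ D•_{≤6}`). [cite: MochizukiAbsTopIII2015, Cor 5.10 (iv)(b) p. 148] -/
def embMonoPlus (v : Vmod) :
    (logShapePlus (isArc := isArc) v).Vertex ⥤q (monoTelecoreShape (Vmod := Vmod) (isArc := isArc) J).Vertex where
  obj a := match a with
    | ExtVertex.base a => ExtVertex.base ⟨a.1, monoBase_six_of_inTwo a.2⟩
    | ExtVertex.obs => ExtVertex.base ⟨.nplus v, monoBase_six_nplus v⟩
  map {a b} e := match a, b, e with
    | ExtVertex.base _, ExtVertex.base _, e => e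
    | ExtVertex.base _, ExtVertex.obs, i => i
    | ExtVertex.obs, ExtVertex.base _, j => PEmpty.elim j
    | ExtVertex.obs, ExtVertex.obs, e => PEmpty.elim e

/-- the inclusion of oriented graphs `Γ⃗_{(D•_{≤3})_v ∪ {𝒩_v}} ↪ Γ⃗_{D_{An⊢}}` (the observation vertex `𝒩_v` of `S_log` is a vertex of
`D•_{≤6} ⊆ D•⊢_{≤5} ∪ D•_{≤6}`). [cite: MochizukiAbsTopIII2015, Cor 5.10 (iv)(b) p. 148] -/
def embMonoTS (v : Vmod) :
    (logShapeTS (isArc := isArc) v).Vertex ⥤q (monoTelecoreShape (Vmod := Vmod) (isArc := isArc) J).Vertex where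
  obj a := match a with
    | ExtVertex.base a => ExtVertex.base ⟨a.1, monoBase_six_of_inPortionThree a.2⟩
    | ExtVertex.obs => ExtVertex.base ⟨.nv v, monoBase_six_nv v⟩
  map {a b} e := match a, b, e with
    | ExtVertex.base _, ExtVertex.base _, e => e
    | ExtVertex.base _, ExtVertex.obs, i => i
    | ExtVertex.obs, ExtVertex.base _, j => PEmpty.elim j
    | ExtVertex.obs, ExtVertex.obs, e => PEmpty.elim e

end Embeddings

/-- the family of homotopies of `S_log⊞` at `v` EMBEDS into a family `K` on `D_{An⊢}` (every boundary pair of `H` is, after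
embedding, a boundary pair of `K` with the same homotopy). [cite: MochizukiAbsTopIII2015, Cor 5.10 (iv)(b) p. 148] -/
def CompatibleInMonoTelecorePlus (J : DSub (monoBase (Vmod := Vmod) (isArc := isArc) 6) → Type u)
    (tel : ∀ {a : DSub (monoBase (Vmod := Vmod) (isArc := isArc) 6)}, J a → (L.AnMono ⥤ a.1.category L))
    (K : (L.monoTelecoreDiagram J tel).HomotopyFamily) (v : Vmod) (H : (L.logDiagramPlus v).HomotopyFamily) : Prop :=
  ∀ ⦃a b : (logShapePlus (isArc := isArc) v).Vertex⦄ (p q : Path a b) (h : H.E p q),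
    ∃ h' : K.E ((embMonoPlus J v).mapPath p) ((embMonoPlus J v).mapPath q), HEq (H.η h) (K.η h')

/-- the family of homotopies of `S_log` at `v` EMBEDS into a family `K` on `D_{An⊢}`. [cite: MochizukiAbsTopIII2015, Cor 5.10 (iv)(b) p. 148] -/
def CompatibleInMonoTelecoreTS (J : DSub (monoBase (Vmod := Vmod) (isArc := isArc) 6) → Type u)
    (tel : ∀ {a : DSub (monoBase (Vmod := Vmod) (isArc := isArc) 6)}, J a → (L.AnMono ⥤ a.1.category L))
    (K : (L.monoTelecoreDiagram J tel).HomotopyFamily) (v : Vmod) (H : (L.logDiagramTS v).HomotopyFamily) : Prop :=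
  ∀ ⦃a b : (logShapeTS (isArc := isArc) v).Vertex⦄ (p q : Path a b) (h : H.E p q),
    ∃ h' : K.E ((embMonoTS J v).mapPath p) ((embMonoTS J v).mapPath q), HEq (H.η h) (K.η h')

/-- the homotopies of `S_log⊞` at `v` **indexed by the edges of `Γ⃗×_v` only** — the generator pairs `([λ⊞_{v,ν₁}], [λ⊞_{v,ν₂}])`
of `IsLogObservablePlus` clause (2) for `ε : ν₁ → ν₂` an edge of `Γ⃗×_v` (`LogEdgeTS.InCore`; this excludes the log arrow
`k~ →(id) k~` leaving the post-log vertex and the space-link arrow `↪ k̄`: "indexed by `ε ∈ Γ⃗×_v` [not `Γ⃗^log_v`!]") — EMBED into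
a family `K` on `D_{An⊢}`. [cite: MochizukiAbsTopIII2015, Cor 5.10 (iv)(c) p. 148] -/
def CoreEdgesCompatibleInMonoTelecorePlus (J : DSub (monoBase (Vmod := Vmod) (isArc := isArc) 6) → Type u)
    (tel : ∀ {a : DSub (monoBase (Vmod := Vmod) (isArc := isArc) 6)}, J a → (L.AnMono ⥤ a.1.category L))
    (K : (L.monoTelecoreDiagram J tel).HomotopyFamily) (v : Vmod) (H : (L.logDiagramPlus v).HomotopyFamily) : Prop :=
  ∀ (ν₁ ν₂ : LogVertex (isArc v)) (ε : LogEdge (isArc v) ν₁ ν₂), ε.toTS.InCore →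
    ∀ (h₁ : ν₁.isPostLog = false) (h₂ : ν₂.isPostLog = false) (h : H.E (lamPath v ν₁ h₁) (lamPath v ν₂ h₂)),
      ∃ h' : K.E ((embMonoPlus J v).mapPath (lamPath v ν₁ h₁)) ((embMonoPlus J v).mapPath (lamPath v ν₂ h₂)),
        HEq (H.η h) (K.η h')

/-- the homotopies of `S_log` at `v` **indexed by the edges of `Γ⃗×_v` only** (generator pairs `([λ_{v,ν₁}], [λ_{v,ν₂}])` of
`IsLogObservableTS` clause (2) for `ε ∈ Γ⃗×_v`) EMBED into a family `K` on `D_{An⊢}`. [cite: MochizukiAbsTopIII2015, Cor 5.10 (iv)(c) p. 148] -/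
def CoreEdgesCompatibleInMonoTelecoreTS (J : DSub (monoBase (Vmod := Vmod) (isArc := isArc) 6) → Type u)
    (tel : ∀ {a : DSub (monoBase (Vmod := Vmod) (isArc := isArc) 6)}, J a → (L.AnMono ⥤ a.1.category L))
    (K : (L.monoTelecoreDiagram J tel).HomotopyFamily) (v : Vmod) (H : (L.logDiagramTS v).HomotopyFamily) : Prop :=
  ∀ (ν₁ ν₂ : LogVertex (isArc v)) (ε : LogEdgeTS (isArc v) ν₁ ν₂), ε.InCore →
    ∀ (h₁ : ν₁.isPostLog = false) (h₂ : ν₂.isPostLog = false) (h : H.E (lamPathTS v ν₁ h₁) (lamPathTS v ν₂ h₂)),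
      ∃ h' : K.E ((embMonoTS J v).mapPath (lamPathTS v ν₁ h₁)) ((embMonoTS J v).mapPath (lamPathTS v ν₂ h₂)),
        HEq (H.η h) (K.η h')

/-! ## Corollary 5.10 (iv)(b), last sentence: `𝔗_{An⊢}` and `S_log`, `S_log⊞` are compatible -/

/-- ★ **Cor 5.10 (iv)(b), last sentence (`s_b′`)** (assumption on `(L, TS)`): "the respective family of homotopies of `𝔗_{An⊢}`
and the observables `S_log`, `S_log⊞` of Corollary 5.5, (iii), are compatible", inside the telecore diagram `D_{An⊢}`: there
exist a core structure of (iv)(a) with core vertex `An⊢[𝒩⊢⊞]` (`n = 6`) and a telecore `𝔗_{An⊢}` of the printed shape over it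
(telecore edges the `φ^{An⊢⊞}_{v,ν}`, `v ∈ V(F_mod)`, `ν ∈ Γ⃗×_v`, with these functors: `hJ`, `htel` — the binders of
`Cor510MonoTelecorePinned` verbatim), observable structures `S_log⊞_v` (`IsLogObservablePlus`) and `S_log_v`
(`IsLogObservableTS TS`) at every `v ∈ V(F_mod)`, and ONE family of homotopies `K` on `D_{An⊢}` (Def 3.5 (ii) "compatible")
that contains the telecore family `𝒥` (hence, by `𝒥|_𝒮 = ℋ`, the core family of `An⊢[𝒩⊢⊞]`) and the embedded families of all
the `S_log⊞_v`, `S_log_v` — the homotopies indexed by ALL of `Γ⃗^log_v`, the log arrow included.  Degenerate boundary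
(disclosure): FALSE as typed for `V(F_mod) = ∅` (no core with core vertex `An⊢[𝒩⊢⊞]`: `□` does not reach it,
`not_cor510MonoTelecoreObservablesCompatible_of_isEmpty`), exactly as `Cor510MonoTelecorePinned`
(`not_cor510MonoTelecorePinned_of_isEmpty`); an assumption on the genuine theaters, where `V(F_mod) ≠ ∅`.
[cite: MochizukiAbsTopIII2015, Cor 5.10 (iv)(b) pp. 147–148] -/
def Cor510MonoTelecoreObservablesCompatible (TS : L.TSHomotopies) : Prop :=
  ∃ (H : ((L.subdiagram (monoBase (isArc := isArc) 6)).extend (L.obsExt (monoBase 6) .anMono)).HomotopyFamily)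
    (hH : ∀ ⦃a b : (obsShape (monoBase (isArc := isArc) 6) DVertex.anMono).Vertex⦄ ⦃p q : Path a b⦄,
      H.E p q → b = (obsShape (monoBase (isArc := isArc) 6) DVertex.anMono).obs)
    (hc : (DiagramOfCategories.Observable.mk _ (fun _ => (inferInstance : IsEmpty PEmpty.{u + 1})) _ H hH).IsCore)
    (T : DiagramOfCategories.Telecore _ _ hc)
    (_ : T.J = (fun a => MonoTelecoreIdx a.1))
    (_ : HEq (fun (a : DSub (monoBase (isArc := isArc) 6)) (j : T.J a) => T.telMap j)
      (fun (a : DSub (monoBase (isArc := isArc) 6)) (j : MonoTelecoreIdx a.1) => L.monoTelecoreFun a.1 j))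
    (Hplus : ∀ v : Vmod, (L.logDiagramPlus v).HomotopyFamily) (Hts : ∀ v : Vmod, (L.logDiagramTS v).HomotopyFamily)
    (K : (L.monoTelecoreDiagram T.J T.telMap).HomotopyFamily),
    (∀ v : Vmod, L.IsLogObservablePlus v (Hplus v) ∧ L.IsLogObservableTS TS v (Hts v)) ∧
      SubFamily T.Jfam K ∧
      ∀ v : Vmod, L.CompatibleInMonoTelecorePlus T.J T.telMap K v (Hplus v) ∧
        L.CompatibleInMonoTelecoreTS T.J T.telMap K v (Hts v)

/-! ## Corollary 5.10 (iv)(c), observable clause: `ℋ_{An⊢}` and the `Γ⃗×_v`-indexed observable homotopies are compatible -/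

/-- ★ **Cor 5.10 (iv)(c), the observable clause** (assumption on `(L, TS)`): "[the contact structure `ℋ_{An⊢}` on `𝔗_{An⊢}`] is
compatible … with the homotopies of the observables `S_log`, `S_log⊞` of Corollary 5.5, (iii), that arise from the `ι⊞_{v,ε}`,
`ι_{v,ε}` indexed by `ε ∈ Γ⃗×_v` [not `Γ⃗^log_v`!]": the pinned telecore `𝔗_{An⊢}` and a contact structure `ℋ_{An⊢}` on it with
the pinned pairs `(γ¹_{v,ν}, γ⁰_{v,ν})` in both orders — the binders of `Cor510MonoTelecorePinned` VERBATIM —, observable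
structures `S_log⊞_v`, `S_log_v` at every `v`, and ONE family of homotopies `K′` on `D_{An⊢}` containing `𝒥`, `ℋ_{An⊢}` and, for
every `v` and every edge `ε : ν₁ → ν₂` of `Γ⃗×_v`, the embedded observable pairs `([λ⊞_{v,ν₁}], [λ⊞_{v,ν₂}])`,
`([λ_{v,ν₁}], [λ_{v,ν₂}])` with their homotopies `ι⊞_{v,ε}`, `ι_{v,ε}` (the log-edge and space-link homotopies EXCLUDED, as
printed).  NOT included: the compatibility with `𝔗_{An•}`, `ℋ_{An•}` (different telecore diagram; successor row) and the
`ι^{An⊢⊞}`-generation clause (abc-iut-L4-t3's `IotaAnMono`/`EtaNatural` lane). [cite: MochizukiAbsTopIII2015, Cor 5.10 (iv)(c) p. 148] -/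
def Cor510MonoContactObservablesCompatible (TS : L.TSHomotopies) : Prop :=
  ∃ (H : ((L.subdiagram (monoBase (isArc := isArc) 6)).extend (L.obsExt (monoBase 6) .anMono)).HomotopyFamily)
    (hH : ∀ ⦃a b : (obsShape (monoBase (isArc := isArc) 6) DVertex.anMono).Vertex⦄ ⦃p q : Path a b⦄,
      H.E p q → b = (obsShape (monoBase (isArc := isArc) 6) DVertex.anMono).obs)
    (hc : (DiagramOfCategories.Observable.mk _ (fun _ => (inferInstance : IsEmpty PEmpty.{u + 1})) _ H hH).IsCore)
    (T : DiagramOfCategories.Telecore _ _ hc)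
    (hJ : T.J = (fun a => MonoTelecoreIdx a.1))
    (_ : HEq (fun (a : DSub (monoBase (isArc := isArc) 6)) (j : T.J a) => T.telMap j)
      (fun (a : DSub (monoBase (isArc := isArc) 6)) (j : MonoTelecoreIdx a.1) => L.monoTelecoreFun a.1 j))
    (Hc : (L.monoTelecoreDiagram T.J T.telMap).HomotopyFamily)
    (_ : DiagramOfCategories.Telecore.IsContactStructure _ T Hc)
    (_ : ∀ (v : Vmod) (ν : LogVertex (isArc v)) (hν : ν.IsCross)
        (hcore : monoBase (isArc := isArc) 6 .core) (hnp : monoBase (isArc := isArc) 6 (.nplus v))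
        (hnv : monoBase (isArc := isArc) 6 (.nv v)) (he5 : monoBase (isArc := isArc) 6 .e5)
        (hem : monoBase (isArc := isArc) 6 .emono5) (hnm : monoBase (isArc := isArc) 6 (.nmonoPlus v)),
        let X' : ExtShape.{u} (DSub (monoBase (isArc := isArc) 6)) := monoTelecoreShape T.J
        let γ₁ : Path (X'.base ⟨.core, hcore⟩) (X'.base ⟨.nmonoPlus v, hnm⟩) :=
          ((((((Path.nil.cons (show X'.base ⟨.core, hcore⟩ ⟶ X'.base ⟨.nplus v, hnp⟩ from DEdge.lam v ν hν.1)).cons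
            (show X'.base ⟨.nplus v, hnp⟩ ⟶ X'.base ⟨.nv v, hnv⟩ from DEdge.forget v)).cons
            (show X'.base ⟨.nv v, hnv⟩ ⟶ X'.base ⟨.e5, he5⟩ from DEdge.toE v)).cons
            (show X'.base ⟨.e5, he5⟩ ⟶ X'.base ⟨.emono5, hem⟩ from DEdge.monoE5)).cons
            (show X'.base ⟨.emono5, hem⟩ ⟶ X'.obs from DEdge.κAnMono)).cons
            (show X'.obs ⟶ X'.base ⟨.nmonoPlus v, hnm⟩ from pinnedEdge hJ v hnm ν hν))
        let γ₀ : Path (X'.base ⟨.core, hcore⟩) (X'.base ⟨.nmonoPlus v, hnm⟩) :=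
          ((Path.nil.cons (show X'.base ⟨.core, hcore⟩ ⟶ X'.base ⟨.nplus v, hnp⟩ from DEdge.lam v ν hν.1)).cons
            (show X'.base ⟨.nplus v, hnp⟩ ⟶ X'.base ⟨.nmonoPlus v, hnm⟩ from DEdge.monoNplus v))
        Hc.E γ₁ γ₀ ∧ Hc.E γ₀ γ₁)
    (Hplus : ∀ v : Vmod, (L.logDiagramPlus v).HomotopyFamily) (Hts : ∀ v : Vmod, (L.logDiagramTS v).HomotopyFamily)
    (K' : (L.monoTelecoreDiagram T.J T.telMap).HomotopyFamily),
    (∀ v : Vmod, L.IsLogObservablePlus v (Hplus v) ∧ L.IsLogObservableTS TS v (Hts v)) ∧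
      SubFamily T.Jfam K' ∧ SubFamily Hc K' ∧
      ∀ v : Vmod, L.CoreEdgesCompatibleInMonoTelecorePlus T.J T.telMap K' v (Hplus v) ∧
        L.CoreEdgesCompatibleInMonoTelecoreTS T.J T.telMap K' v (Hts v)

/-! ## What the statements refine; the degenerate boundary -/

/-- `s_b′` refines the core clause of Cor 5.10 (iv)(a) for `n = 6` (`An⊢[𝒩⊢⊞]` a core of `D•⊢_{≤5} ∪ D•_{≤6}`, `IsCoreOn`).
[cite: MochizukiAbsTopIII2015, Cor 5.10 (iv)(a) p. 147] -/
theorem isCoreOn_anMono_of_observablesCompatible (TS : L.TSHomotopies)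
    (h : L.Cor510MonoTelecoreObservablesCompatible TS) : L.IsCoreOn (monoBase 6) .anMono := by
  obtain ⟨H, hH, hc, -⟩ := h
  exact ⟨H, hH, hc⟩

/-- `s_b′` refines the existence clauses of Cor 5.5 (iii) (`Cor55Observables`, `Cor55ObservablesTS`).
[cite: MochizukiAbsTopIII2015, Cor 5.5 (iii) p. 131] -/
theorem cor55Observables_of_observablesCompatible (TS : L.TSHomotopies)
    (h : L.Cor510MonoTelecoreObservablesCompatible TS) : L.Cor55Observables ∧ L.Cor55ObservablesTS TS := by
  obtain ⟨_, _, _, _, _, _, Hplus, Hts, _, hobs, _⟩ := h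
  exact ⟨fun v => ⟨Hplus v, (hobs v).1⟩, fun v => ⟨Hts v, (hobs v).2⟩⟩

/-- the (c)-clause statement refines the pinned row `Cor510MonoTelecorePinned` (its binders are carried verbatim).
[cite: MochizukiAbsTopIII2015, Cor 5.10 (iv)(b)(c) pp. 147–148] -/
theorem cor510MonoTelecorePinned_of_contactObservablesCompatible (TS : L.TSHomotopies)
    (h : L.Cor510MonoContactObservablesCompatible TS) : L.Cor510MonoTelecorePinned := by
  obtain ⟨H, hH, hc, T, hJ, htel, Hc, hcs, hpairs, -⟩ := h
  exact ⟨H, hH, hc, T, hJ, htel, Hc, hcs, hpairs⟩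

/-- the (c)-clause statement refines the existence clauses of Cor 5.5 (iii) as well.
[cite: MochizukiAbsTopIII2015, Cor 5.5 (iii) p. 131] -/
theorem cor55Observables_of_contactObservablesCompatible (TS : L.TSHomotopies)
    (h : L.Cor510MonoContactObservablesCompatible TS) : L.Cor55Observables ∧ L.Cor55ObservablesTS TS := by
  obtain ⟨_, _, _, _, _, _, _, _, _, Hplus, Hts, _, hobs, _⟩ := h
  exact ⟨fun v => ⟨Hplus v, (hobs v).1⟩, fun v => ⟨Hts v, (hobs v).2⟩⟩

/-- **`V(F_mod) ≠ ∅` is necessary for `s_b′` as typed**: with `Vmod` empty the vertex `□` has no outgoing arrow, so no core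
structure with core vertex `An⊢[𝒩⊢⊞]` exists (abc-iut-L4-t15's `eq_core_of_path_of_isEmpty`, as in abc-iut-f-101's
`not_cor510MonoTelecorePinned_of_isEmpty`). [cite: MochizukiAbsTopIII2015, Cor 5.10 (iv)(a)(b) p. 147] -/
theorem not_cor510MonoTelecoreObservablesCompatible_of_isEmpty [IsEmpty Vmod] (TS : L.TSHomotopies) :
    ¬ L.Cor510MonoTelecoreObservablesCompatible TS := by
  rintro ⟨H, hH, hcore, -⟩
  obtain ⟨p⟩ := hcore.reaches_obs ⟨.core, monoBase_six_core⟩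
  have h := eq_core_of_path_of_isEmpty (P := monoBase 6) monoBase_six_core (x := .anMono)
    (fun i => by cases i) p
  change ExtVertex.obs = ExtVertex.base _ at h
  cases h

/-- **`V(F_mod) ≠ ∅` is necessary for the (c)-clause statement as typed** (it refines the pinned row).
[cite: MochizukiAbsTopIII2015, Cor 5.10 (iv)(b)(c) pp. 147–148] -/
theorem not_cor510MonoContactObservablesCompatible_of_isEmpty [IsEmpty Vmod] (TS : L.TSHomotopies) :
    ¬ L.Cor510MonoContactObservablesCompatible TS := by
  rintro ⟨H, hH, hcore, -⟩
  obtain ⟨p⟩ := hcore.reaches_obs ⟨.core, monoBase_six_core⟩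
  have h := eq_core_of_path_of_isEmpty (P := monoBase 6) monoBase_six_core (x := .anMono)
    (fun i => by cases i) p
  change ExtVertex.obs = ExtVertex.base _ at h
  cases h

end LogFrobeniusSetting

end Literature.AnabelianGeometry.AbsoluteAnabelian
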